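/-
Copyright (c) 2026 the pub-hodgecm-mathlib formalisation cell (harness21).  Prover seat hodgecm-mathlib-K2E3-p21 (g5), Track B «K2-LIT» ∕ h413
(`stmt-HodgeConjecture-24833`), line `K2_E3_EllipticInputs`, unit U12 §L, road «GL-[M6]-sc» (line lead K2E3-p23 (g5), RULINGS #11 (M11-3): T20-GL₃ co-owned with
K2E5-p17 (g4); split 2026-09-04T06:54:47Z: this seat = «(B)'s Iwahori ∕ conjugation half»), brick T20-GL₃ (B-Iw), FILE 1: «THE THREE-FACTOR IWAHORI ORDER OF THE PRINCIPAL
CONGRUENCE SUBGROUPS OF `GL_n(F)` W.R.T. A TWO-BLOCK PARABOLIC, AND ITS CONJUGATES».  2026-09-04.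
-/
import Literature.NumberTheory.Automorphic.GLnCongruenceSubgroups        -- ★ `congruenceGL`, `ValBound`, `exists_unipotent_mul_opposite_of_mem_congruenceGL`, `isUnit_det_and_valBound_inv`, `oppositeParabolicGL`
import Literature.NumberTheory.Automorphic.GLnTwoBlockLeviStructure      -- ★ `mem_standardLeviGL_iff`, `conj_mem_unipotentRadicalGL_of_mem_standardLeviGL`
import Literature.NumberTheory.Automorphic.HeckeTransversalGL            -- ★ `permGL`, `permGL_mem_glInt`
import HarnessLib

/-!
# K2_E3 road (h413), Theorem 20 for `GL₃` (T20-GL₃), input file (B-Iw) 1: the Iwahori order `K_γ = (K_γ ∩ V_c)(K_γ ∩ M_c)(K_γ ∩ U_c)` of a principal congruence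
# subgroup of `GL_n(F)` w.r.t. a two-block standard parabolic `P_c = M_c U_c` and its opposite radical `V_c`, in both orders, and its transport under `GL_n(𝒪)`-conjugation

Cell `pub/hodgecm-mathlib` (D-0151), Track B, seat K2E3-p21 (g5); T20-GL₃ co-owner K2E5-p17 (g4) (consumer: ★ (A) `K2E3CuspFormCancellationPolychotomy`, binder
`hIw : ∀ k ∈ K₀, ∃ v ∈ K₀ ⊓ V, ∃ t ∈ K₀ ⊓ T, ∃ u ∈ K₀ ⊓ U, k = v * t * u`, and files (B)∕(C) `K2E3GL3CuspFormCancellation{Inputs,}`); line lead K2E3-p23 (g5).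
`--supports stmt-HodgeConjecture-24833 --as helper`; THEOREMS ONLY (no definition ∕ instance ∕ notation ∕ named-fact hypothesis ∕ `sorry`).

NOTATION (spelled out): `K_γ = congruenceGL n γ` (★), `γ < 1`; `c : Fin n → Fin 2` a two-block labelling; `U_c = unipotentRadicalGL F c`, `M_c = standardLeviGL F c`,
`P_c⁻ = oppositeParabolicGL F c = standardParabolicGL F (toDual ∘ c)` (★) and the OPPOSITE RADICAL `V_c := unipotentRadicalGL F (OrderDual.toDual ∘ c)`.

THE MATHEMATICS [Casselman1995, Prop. 1.4.4 («Iwahori factorization»: `K = (K ∩ N⁻)(K ∩ M)(K ∩ N)`)]; [BernsteinZelevinsky1976, §3.11]; [HarishChandra1970, Part VII §8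
p. 81 (`K = (N̄ ∩ K)(M ∩ K)(N ∩ K)`)].  ★ `exists_unipotent_mul_opposite_of_mem_congruenceGL` gives `K_γ = (K_γ ∩ U_c)(K_γ ∩ P_c⁻)`; this file adds the LEVI SPLITTING
`K_γ ∩ P_c⁻ = (K_γ ∩ M_c)(K_γ ∩ V_c)` (the block-diagonal part `t` of a `γ`-congruent matrix is `γ`-congruent and invertible, ★ `isUnit_det_and_valBound_inv`; `t⁻¹ p` is
then unipotent block-lower-triangular), whence both three-factor orders, and the transport of any such order under conjugation by `w ∈ GL_n(𝒪)` (which normalises `K_γ`).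
* §1 dictionary: `standardLeviGL_toDual_comp` (`M_{c⁻} = M_c`), `unipotentRadicalGL_eq_of_forall_le_iff` (two labellings with the same preorder have the same radical —
  e.g. `Fin 2` vs `Bool` labels, ★ B4-E1's currency), `conj_mem_congruenceGL_of_mem_glInt` (`GL_n(𝒪)` normalises `K_γ`).
* §2 **`exists_levi_mul_oppositeRadical_of_mem_congruenceGL`** (`p ∈ P_c⁻ ∩ K_γ ⇒ p = t v`, `t ∈ M_c ∩ K_γ`, `v ∈ V_c ∩ K_γ`).
* §3 **`exists_iwahori_vtu_of_mem_congruenceGL`** (`k = v t u`, the ★ (A) `hIw` order for the triple `(V_c, M_c, U_c)`) and **`exists_iwahori_utv_of_mem_congruenceGL`**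
  (`k = u t v`, the `hIw` order for the triple `(U_c, M_c, V_c)` — the case where the OPPOSITE radical is the contracted one).
* §4 **`iwahori_map_conj`** (generic group lemma: an Iwahori order of `K₀` w.r.t. `(V, T, U)` gives one w.r.t. `(wVw⁻¹, wTw⁻¹, wUw⁻¹)` when `w^{±1}` normalise `K₀`) and the
  `GL_n(𝒪)` ∕ permutation-matrix instances **`exists_iwahori_vtu_map_conj_of_mem_congruenceGL`**, `…_utv_…` (the six Weyl chambers of T20-GL₃).

HONEST LABEL: HC_CM is proved only modulo the 7 printed citations (2 remaining named inputs: hLiu418 = `stmt-HodgeConjecture-24832`, h413 = `stmt-HodgeConjecture-24833`)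
until rung 0 closes; this file is a count-neutral helper and closes no socket.

## References
* [Casselman1995] W. Casselman, *Introduction to the theory of admissible representations of `p`-adic reductive groups* (1995 notes), Prop. 1.4.3–1.4.4.
* [BernsteinZelevinsky1976] I. N. Bernstein, A. V. Zelevinsky, *Representations of the group GL(n, F) where F is a non-archimedean local field*, Russian Math.
  Surveys 31:3 (1976), §3.11.
* [HarishChandra1970] Harish-Chandra (notes by G. van Dijk), *Harmonic Analysis on Reductive p-adic Groups*, LNM 162 (1970), Part VII §8 pp. 80–84.
-/

set_option autoImplicit false
-- the mandated namespace repeats the single-problem summit's segment (`HodgeConjecture.HodgeConjecture`)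
set_option linter.dupNamespace false

open scoped MatrixGroups Pointwise
open ValuativeRel Matrix
open Literature.NumberTheory.Automorphic

namespace Summit.HodgeConjecture.HodgeConjecture.Cruxes.H413.K2E3GLnCongruenceIwahoriTriple

/-! ## §1  Dictionary and normality -/

section Dictionary

variable {F : Type*} [Field F] {n : ℕ}

/-- **`M_{c⁻} = M_c`**: the standard Levi of the reversed labelling is the same block-diagonal subgroup. [cite: Casselman1995, Prop. 1.4.4] -/
theorem standardLeviGL_toDual_comp {α : Type*} [LinearOrder α] [Fintype α] (c : Fin n → α) :
    standardLeviGL F (OrderDual.toDual ∘ c) = standardLeviGL F c := by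
  ext g
  rw [mem_standardLeviGL_iff, mem_standardLeviGL_iff]
  constructor
  · intro h i j hij
    exact h i j fun h' => hij (OrderDual.toDual.injective h')
  · intro h i j hij
    refine h i j fun h' => hij ?_
    show OrderDual.toDual (c i) = OrderDual.toDual (c j)
    rw [h']

/-- **Two labellings with the same block preorder have the same unipotent radical** (e.g. `Fin 2`-valued vs `Bool`-valued two-block labels, or `toDual ∘ c` vs an
antitone relabelling). [folklore] -/
theorem unipotentRadicalGL_eq_of_forall_le_iff {α β : Type*} [LinearOrder α] [LinearOrder β] {c₁ : Fin n → α} {c₂ : Fin n → β}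
    (h : ∀ i j, c₁ j ≤ c₁ i ↔ c₂ j ≤ c₂ i) : unipotentRadicalGL F c₁ = unipotentRadicalGL F c₂ := by
  ext g
  rw [mem_unipotentRadicalGL_iff_apply, mem_unipotentRadicalGL_iff_apply]
  exact ⟨fun hg i j hij => hg i j ((h i j).2 hij), fun hg i j hij => hg i j ((h i j).1 hij)⟩

/-- **Two labellings with the same block partition have the same Levi.** [folklore] -/
theorem standardLeviGL_eq_of_forall_eq_iff {α β : Type*} [LinearOrder α] [Fintype α] [LinearOrder β] [Fintype β] {c₁ : Fin n → α} {c₂ : Fin n → β}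
    (h : ∀ i j, c₁ i = c₁ j ↔ c₂ i = c₂ j) : standardLeviGL F c₁ = standardLeviGL F c₂ := by
  ext g
  rw [mem_standardLeviGL_iff, mem_standardLeviGL_iff]
  exact ⟨fun hg i j hij => hg i j (fun h' => hij ((h i j).1 h')), fun hg i j hij => hg i j (fun h' => hij ((h i j).2 h'))⟩

variable [ValuativeRel F]

/-- **`GL_n(𝒪)` NORMALISES EVERY PRINCIPAL CONGRUENCE SUBGROUP**: `w k w⁻¹ ∈ K_γ` for `w ∈ GL_n(𝒪)`, `k ∈ K_γ` (`w (k − 1) w⁻¹` has entries `≤ 1·γ·1`).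
[cite: Casselman1995, Prop. 1.4.3] -/
theorem conj_mem_congruenceGL_of_mem_glInt {γ : ValueGroupWithZero F} {w k : GL (Fin n) F} (hw : w ∈ glInt n F) (hk : k ∈ congruenceGL n γ) :
    w * k * w⁻¹ ∈ congruenceGL n γ := by
  rw [mem_glInt_iff] at hw
  have hw1 : ValBound 1 (w : Matrix (Fin n) (Fin n) F) := fun i j => (Valuation.mem_integer_iff _ _).1 (hw.1 i j)
  have hw2 : ValBound 1 ((w⁻¹ : GL (Fin n) F) : Matrix (Fin n) (Fin n) F) := fun i j => (Valuation.mem_integer_iff _ _).1 (hw.2 i j)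
  obtain ⟨⟨hk1, hk2⟩, hk3, hk4⟩ := hk
  refine ⟨⟨?_, ?_⟩, ?_, ?_⟩
  · simpa only [Units.val_mul, one_mul, mul_one] using (hw1.mul hk1).mul hw2
  · rw [_root_.mul_inv_rev, _root_.mul_inv_rev, inv_inv, ← mul_assoc]
    simpa only [Units.val_mul, one_mul, mul_one] using (hw1.mul hk2).mul hw2
  · have heq : ((w * k * w⁻¹ : GL (Fin n) F) : Matrix (Fin n) (Fin n) F) - 1 =
        (w : Matrix (Fin n) (Fin n) F) * ((k : Matrix (Fin n) (Fin n) F) - 1) * ((w⁻¹ : GL (Fin n) F) : Matrix (Fin n) (Fin n) F) := by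
      rw [Units.val_mul, Units.val_mul, Matrix.mul_sub, Matrix.mul_one, Matrix.sub_mul, Units.mul_inv]
    rw [heq]
    simpa only [one_mul, mul_one] using (hw1.mul hk3).mul hw2
  · have heq : (((w * k * w⁻¹)⁻¹ : GL (Fin n) F) : Matrix (Fin n) (Fin n) F) - 1 =
        (w : Matrix (Fin n) (Fin n) F) * (((k⁻¹ : GL (Fin n) F) : Matrix (Fin n) (Fin n) F) - 1) * ((w⁻¹ : GL (Fin n) F) : Matrix (Fin n) (Fin n) F) := by
      rw [_root_.mul_inv_rev, _root_.mul_inv_rev, inv_inv, ← mul_assoc, Units.val_mul, Units.val_mul, Matrix.mul_sub, Matrix.mul_one, Matrix.sub_mul, Units.mul_inv]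
    rw [heq]
    simpa only [one_mul, mul_one] using (hw1.mul hk4).mul hw2

/-- Permutation matrices normalise `K_γ` (★ `permGL_mem_glInt`). [cite: Casselman1995, Prop. 1.4.3] -/
theorem permGL_conj_mem_congruenceGL {γ : ValueGroupWithZero F} (σ : Equiv.Perm (Fin n)) {k : GL (Fin n) F} (hk : k ∈ congruenceGL n γ) :
    permGL σ * k * (permGL σ)⁻¹ ∈ congruenceGL n γ :=
  conj_mem_congruenceGL_of_mem_glInt (permGL_mem_glInt σ) hk

end Dictionary

/-! ## §2  The Levi splitting `K_γ ∩ P_c⁻ = (K_γ ∩ M_c)(K_γ ∩ V_c)` -/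

section Levi

variable {F : Type*} [Field F] [ValuativeRel F] {n : ℕ} {c : Fin n → Fin 2}

/-- **LEVI SPLITTING OF THE CONGRUENT OPPOSITE PARABOLIC**: for `γ < 1` and `p ∈ P_c⁻ ∩ K_γ`, the block-diagonal part `t` of `p` lies in `M_c ∩ K_γ` (a
`γ`-congruent matrix with some entries zeroed is `γ`-congruent, hence invertible with `γ`-congruent inverse, ★ `isUnit_det_and_valBound_inv`) and `v = t⁻¹ p ∈ V_c ∩ K_γ` is
unipotent block-lower-triangular; `p = t v`. [cite: Casselman1995, Prop. 1.4.4] [cite: HarishChandra1970, Part VII §8 p. 81] -/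
theorem exists_levi_mul_oppositeRadical_of_mem_congruenceGL {γ : ValueGroupWithZero F} (hγ : γ < 1) {p : GL (Fin n) F}
    (hp : p ∈ oppositeParabolicGL F c) (hpK : p ∈ congruenceGL n γ) :
    ∃ t ∈ standardLeviGL F c, ∃ v ∈ unipotentRadicalGL F (OrderDual.toDual ∘ c),
      t ∈ congruenceGL n γ ∧ v ∈ congruenceGL n γ ∧ p = t * v := by
  classical
  -- the block-diagonal part `T` of `p` and its congruence
  set T : Matrix (Fin n) (Fin n) F := Matrix.of fun i j => if c i = c j then (p : Matrix (Fin n) (Fin n) F) i j else 0 with hT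
  have hT1 : ValBound γ (T - 1) := by
    intro i j
    by_cases hij : c i = c j
    · have h := hpK.2.1 i j
      rw [Matrix.sub_apply] at h ⊢
      rw [hT, Matrix.of_apply, if_pos hij]
      exact h
    · have hne : i ≠ j := fun h => hij (congrArg c h)
      rw [Matrix.sub_apply, hT, Matrix.of_apply, if_neg hij, Matrix.one_apply_ne hne, sub_zero, map_zero]
      exact zero_le
  obtain ⟨hTunit, hTinv1, hTinvγ⟩ := isUnit_det_and_valBound_inv hT1 hγ
  set t : GL (Fin n) F := Matrix.GeneralLinearGroup.mkOfDetNeZero T hTunit.ne_zero with ht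
  have ht_coe : (t : Matrix (Fin n) (Fin n) F) = T := rfl
  have ht_inv : ((t⁻¹ : GL (Fin n) F) : Matrix (Fin n) (Fin n) F) = T⁻¹ := by
    rw [Matrix.coe_units_inv, ht_coe]
  have htK : t ∈ congruenceGL n γ := by
    refine ⟨⟨?_, ?_⟩, ?_, ?_⟩
    · rw [ht_coe]; exact hT1.of_sub_one hγ.le
    · rw [ht_inv]; exact hTinv1
    · rw [ht_coe]; exact hT1
    · rw [ht_inv]; exact hTinvγ
  have htM : t ∈ standardLeviGL F c := (mem_standardLeviGL_iff c t).2 fun i j hij => by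
    rw [ht_coe, hT, Matrix.of_apply, if_neg hij]
  -- the inverse of the block-diagonal part is block-diagonal
  have htinvM : ∀ i k : Fin n, c i ≠ c k → (T⁻¹) i k = 0 := fun i k hik => by
    rw [← ht_inv]; exact (mem_standardLeviGL_iff c _).1 (Subgroup.inv_mem _ htM) i k hik
  have hp0 : ∀ k j : Fin n, c k < c j → (p : Matrix (Fin n) (Fin n) F) k j = 0 := (mem_oppositeParabolicGL_iff p).1 hp
  refine ⟨t, htM, t⁻¹ * p, ?_, htK, Subgroup.mul_mem _ (Subgroup.inv_mem _ htK) hpK, (mul_inv_cancel_left t p).symm⟩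
  rw [mem_unipotentRadicalGL_iff_apply]
  intro i j hij
  have hij' : c i ≤ c j := hij
  rw [Units.val_mul, ht_inv, Matrix.mul_apply]
  rcases hij'.lt_or_eq with hlt | heq
  · -- strictly above the block diagonal: every term vanishes
    rw [Matrix.one_apply_ne (fun h => hlt.ne (congrArg c h))]
    refine Finset.sum_eq_zero fun k _ => ?_
    by_cases hik : c i = c k
    · rw [hp0 k j (lt_of_eq_of_lt hik.symm hlt), mul_zero]
    · rw [htinvM i k hik, zero_mul]
  · -- on the block diagonal: the block of `T⁻¹ T = 1`
    have h1 : (T⁻¹ * T) i j = (1 : Matrix (Fin n) (Fin n) F) i j := by rw [Matrix.nonsing_inv_mul T hTunit]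
    rw [← h1, Matrix.mul_apply]
    refine Finset.sum_congr rfl fun k _ => ?_
    by_cases hik : c i = c k
    · rw [hT, Matrix.of_apply, if_pos (hik.symm.trans heq)]
    · rw [htinvM i k hik, zero_mul, zero_mul]

end Levi

/-! ## §3  The two three-factor Iwahori orders of `K_γ` -/

section Iwahori

variable {F : Type*} [Field F] [ValuativeRel F] {n : ℕ} {c : Fin n → Fin 2}

/-- **`K_γ = (K_γ ∩ U_c)(K_γ ∩ M_c)(K_γ ∩ V_c)`** (`γ < 1`): every `k ∈ K_γ` is `k = u t v` with `u ∈ U_c`, `t ∈ M_c`, `v ∈ V_c`, all in `K_γ` — the ★ (A) `hIw` order for the triple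
`(V, T, U) := (U_c, M_c, V_c)` (the case in which the OPPOSITE radical `V_c` is the contracted group). [cite: Casselman1995, Prop. 1.4.4] [cite: BernsteinZelevinsky1976, §3.11] -/
theorem exists_iwahori_utv_of_mem_congruenceGL {γ : ValueGroupWithZero F} (hγ : γ < 1) {k : GL (Fin n) F} (hk : k ∈ congruenceGL n γ) :
    ∃ u ∈ congruenceGL n γ ⊓ unipotentRadicalGL F c, ∃ t ∈ congruenceGL n γ ⊓ standardLeviGL F c,
      ∃ v ∈ congruenceGL n γ ⊓ unipotentRadicalGL F (OrderDual.toDual ∘ c), k = u * t * v := by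
  obtain ⟨u, huU, p, hpP, huK, hpK, rfl⟩ := exists_unipotent_mul_opposite_of_mem_congruenceGL (c := c) hγ hk
  obtain ⟨t, htM, v, hvV, htK, hvK, rfl⟩ := exists_levi_mul_oppositeRadical_of_mem_congruenceGL hγ hpP hpK
  exact ⟨u, ⟨huK, huU⟩, t, ⟨htK, htM⟩, v, ⟨hvK, hvV⟩, (mul_assoc u t v).symm⟩

/-- **`K_γ = (K_γ ∩ V_c)(K_γ ∩ M_c)(K_γ ∩ U_c)`** (`γ < 1`): every `k ∈ K_γ` is `k = v t u` — the ★ (A) `hIw` order for the triple `(V, T, U) := (V_c, M_c, U_c)` (the case in which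
the radical `U_c` is contracted).  From the previous order applied to `k⁻¹` and inverting (`(u t v)⁻¹ = v⁻¹ t⁻¹ u⁻¹`).
[cite: Casselman1995, Prop. 1.4.4] [cite: HarishChandra1970, Part VII §8 p. 81] -/
theorem exists_iwahori_vtu_of_mem_congruenceGL {γ : ValueGroupWithZero F} (hγ : γ < 1) {k : GL (Fin n) F} (hk : k ∈ congruenceGL n γ) :
    ∃ v ∈ congruenceGL n γ ⊓ unipotentRadicalGL F (OrderDual.toDual ∘ c), ∃ t ∈ congruenceGL n γ ⊓ standardLeviGL F c,
      ∃ u ∈ congruenceGL n γ ⊓ unipotentRadicalGL F c, k = v * t * u := by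
  obtain ⟨u, ⟨huK, huU⟩, t, ⟨htK, htM⟩, v, ⟨hvK, hvV⟩, hk'⟩ := exists_iwahori_utv_of_mem_congruenceGL (c := c) hγ (Subgroup.inv_mem _ hk)
  refine ⟨v⁻¹, ⟨Subgroup.inv_mem _ hvK, Subgroup.inv_mem _ hvV⟩, t⁻¹, ⟨Subgroup.inv_mem _ htK, Subgroup.inv_mem _ htM⟩,
    u⁻¹, ⟨Subgroup.inv_mem _ huK, Subgroup.inv_mem _ huU⟩, ?_⟩
  rw [← inv_inv k, hk', _root_.mul_inv_rev, _root_.mul_inv_rev, mul_assoc]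

end Iwahori

/-! ## §4  Transport under conjugation: the Weyl-conjugate triples -/

section Conj

/-- **TRANSPORT OF AN IWAHORI ORDER UNDER CONJUGATION** (any group): if `w` and `w⁻¹` normalise `K₀` and `K₀ = (K₀ ∩ V)(K₀ ∩ T)(K₀ ∩ U)`, then
`K₀ = (K₀ ∩ wVw⁻¹)(K₀ ∩ wTw⁻¹)(K₀ ∩ wUw⁻¹)` (`Subgroup.map (MulAut.conj w)`). [cite: HarishChandra1970, Part VII §8 p. 81] -/
theorem iwahori_map_conj {G : Type*} [Group G] (K₀ V T U : Subgroup G) (w : G)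
    (hw : ∀ k ∈ K₀, w * k * w⁻¹ ∈ K₀) (hw' : ∀ k ∈ K₀, w⁻¹ * k * w ∈ K₀)
    (hIw : ∀ k ∈ K₀, ∃ v ∈ K₀ ⊓ V, ∃ t ∈ K₀ ⊓ T, ∃ u ∈ K₀ ⊓ U, k = v * t * u) :
    ∀ k ∈ K₀, ∃ v ∈ K₀ ⊓ V.map (MulAut.conj w).toMonoidHom, ∃ t ∈ K₀ ⊓ T.map (MulAut.conj w).toMonoidHom,
      ∃ u ∈ K₀ ⊓ U.map (MulAut.conj w).toMonoidHom, k = v * t * u := by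
  intro k hk
  obtain ⟨v, ⟨hvK, hvV⟩, t, ⟨htK, htT⟩, u, ⟨huK, huU⟩, hfac⟩ := hIw _ (hw' k hk)
  refine ⟨w * v * w⁻¹, ⟨hw v hvK, Subgroup.mem_map.2 ⟨v, hvV, rfl⟩⟩, w * t * w⁻¹, ⟨hw t htK, Subgroup.mem_map.2 ⟨t, htT, rfl⟩⟩,
    w * u * w⁻¹, ⟨hw u huK, Subgroup.mem_map.2 ⟨u, huU, rfl⟩⟩, ?_⟩
  calc k = w * (w⁻¹ * k * w) * w⁻¹ := by group
    _ = w * (v * t * u) * w⁻¹ := by rw [hfac]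
    _ = w * v * w⁻¹ * (w * t * w⁻¹) * (w * u * w⁻¹) := by group

variable {F : Type*} [Field F] [ValuativeRel F] {n : ℕ} {c : Fin n → Fin 2}

/-- **THE WEYL-CONJUGATE TRIPLES, `v t u` ORDER**: for `w ∈ GL_n(𝒪)` (e.g. a permutation matrix ★ `permGL σ`, ★ `permGL_mem_glInt`) and `γ < 1`,
`K_γ = (K_γ ∩ wV_cw⁻¹)(K_γ ∩ wM_cw⁻¹)(K_γ ∩ wU_cw⁻¹)`. [cite: HarishChandra1970, Part VII §8 p. 81] [cite: Casselman1995, Prop. 1.4.4] -/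
theorem exists_iwahori_vtu_map_conj_of_mem_congruenceGL {γ : ValueGroupWithZero F} (hγ : γ < 1) {w : GL (Fin n) F} (hw : w ∈ glInt n F) :
    ∀ k ∈ congruenceGL n γ,
      ∃ v ∈ congruenceGL n γ ⊓ (unipotentRadicalGL F (OrderDual.toDual ∘ c)).map (MulAut.conj w).toMonoidHom,
      ∃ t ∈ congruenceGL n γ ⊓ (standardLeviGL F c).map (MulAut.conj w).toMonoidHom,
      ∃ u ∈ congruenceGL n γ ⊓ (unipotentRadicalGL F c).map (MulAut.conj w).toMonoidHom, k = v * t * u :=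
  iwahori_map_conj (congruenceGL n γ) _ _ _ w (fun _ hk => conj_mem_congruenceGL_of_mem_glInt hw hk)
    (fun k hk => by
      have h := conj_mem_congruenceGL_of_mem_glInt (Subgroup.inv_mem _ hw) hk
      rwa [inv_inv] at h)
    (fun _ hk => exists_iwahori_vtu_of_mem_congruenceGL hγ hk)

/-- **THE WEYL-CONJUGATE TRIPLES, `u t v` ORDER**: `K_γ = (K_γ ∩ wU_cw⁻¹)(K_γ ∩ wM_cw⁻¹)(K_γ ∩ wV_cw⁻¹)` for `w ∈ GL_n(𝒪)`, `γ < 1`.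
[cite: HarishChandra1970, Part VII §8 p. 81] [cite: Casselman1995, Prop. 1.4.4] -/
theorem exists_iwahori_utv_map_conj_of_mem_congruenceGL {γ : ValueGroupWithZero F} (hγ : γ < 1) {w : GL (Fin n) F} (hw : w ∈ glInt n F) :
    ∀ k ∈ congruenceGL n γ,
      ∃ u ∈ congruenceGL n γ ⊓ (unipotentRadicalGL F c).map (MulAut.conj w).toMonoidHom,
      ∃ t ∈ congruenceGL n γ ⊓ (standardLeviGL F c).map (MulAut.conj w).toMonoidHom,
      ∃ v ∈ congruenceGL n γ ⊓ (unipotentRadicalGL F (OrderDual.toDual ∘ c)).map (MulAut.conj w).toMonoidHom, k = u * t * v :=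
  iwahori_map_conj (congruenceGL n γ) _ _ _ w (fun _ hk => conj_mem_congruenceGL_of_mem_glInt hw hk)
    (fun k hk => by
      have h := conj_mem_congruenceGL_of_mem_glInt (Subgroup.inv_mem _ hw) hk
      rwa [inv_inv] at h)
    (fun _ hk => exists_iwahori_utv_of_mem_congruenceGL hγ hk)

end Conj


end Summit.HodgeConjecture.HodgeConjecture.Cruxes.H413.K2E3GLnCongruenceIwahoriTriple
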